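import Mathlib
import Literature.Barriers.PneNP.TSPExtensionComplexityFaces
import Literature.Computability.AlgebraicComplexity.NestFreeMatchingPoly
import Literature.Computability.AlgebraicComplexity.GrochowMonotoneCircuitQuasiPolyEF
import Literature.Computability.MetaComplexity.GridTseitinLift
import Literature.Combinatorics.SimpleGraph.SubcubicMinors
import Summits.ValiantsHypothesis.ValiantsHypothesis.Theses.FifoMatching
import HarnessLib

/-!
# K1 (`NFPolytopeQuasiPolyXC`) ⇐ the single-window QUEUE-GRID face + the grid pattern polytope (val-idea-7 g6, LENS dual)

Workfile for the rung ABOVE the (closed) crux `NNLinearDegreeCofactorHard` (stmt-23918): the polyhedral door (X) to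
`NNDivisionHard` (stmt-21181) — memo `Lines/internal_cofactor-NEXT-RUNG-dual.md` §8 (rev 1.4).  Honesty: 23918 and
24468 are CLOSED·proved (p606802, p607115); 21181 is OPEN and stays open; VP ≠ VNP is not moved; nothing in this file
is a lower bound for `L₊` unconditionally.  What is kernel-checked here (no `sorry` in this file) is the ASSEMBLY

  `nfp_xc_of_queueGrid : QueueGridFaceProjection → QueueGridPPHard → NFPolytopeQuasiPolyXC`
  (BY NAME for the route item stmt-ValiantsHypothesis-26254 = `Theses.FifoMatching.NFPolytopeQuasiPolyXC` (rev 9, GATED):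
   `theorem k1_of_queueGrid (hF) (hG) : Theses.FifoMatching.NFPolytopeQuasiPolyXC := nfp_xc_of_queueGrid hF hG` is a
   DEFINITIONAL re-typing (the route inlines `nestFreeMatchingPoly` and `newt` verbatim); it is left out of this file only
   because the farm's built `Theses.FifoMatching` predates rev 9 at the time of writing (unknown identifier, 06:45Z) —
   add it, with `import …Theses.FifoMatching`, once the build catches up)

(and hence, composing with `NextRungDual.hd1_of_xc_qp` of `Lines/next_rung_dual.lean`, HD-1 `NNMonomialCofactorHard` from
`MonotoneCircuitQuasiPolyEF` + the two inputs below; `realOf`/`suppPts`/`newt`/`NFPolytopeQuasiPolyXC` are VERBATIM copies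
of the `NextRungDual` declarations — the farm does not serve `Cruxes/` workfiles as imports — so the two
`NFPolytopeQuasiPolyXC` agree by `Iff.rfl` in any file importing both); i.e. i1's K1 («queue-grid-xc», `Ideas/queue-grid-xc.md`) — the ONLY open input of door (X) (`NextRungDual.hd1_of_xc_qp`)
— reduces to two named statements:

* `QueueGridFaceProjection` (NEW, this seat; LOCATED with a complete elementary proof sketch in memo §8.3 and
  verified exhaustively for r ≤ 4, i.e. N ≤ 90, 65 536 designs, 0 rogue vertices — `sim/queue_grid_rigidity_B.py`):
  for every `r ≥ 1` and `n ≥ (r+1)(2r+1)` an affine section of `NFP(2n) = Newt(NN_n)` (in fact the COORDINATE FACE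
  `x_e = 0, e ∉ E*`) projects, by coordinate restriction, EXACTLY onto the pair-pattern polytope `queueGridPP r` of the
  `r × r` queue grid (affinely isomorphic to the Boolean-quadric / correlation polytope `COR(P_{r,r})`).  The gadget is
  the SINGLE-WINDOW layout B: preamble `U^{2r+1}`; stretch `s < r` = frame `U`, windows `W(s,i) ∈ {DDUU, UUDD}`
  (bit `X(s,i)`), frame `D`; postamble `D^{2r+1}`; padding `(UD)^{n-(r+1)(2r+1)}`.  FIFO makes window `(s+1,i)`'s two
  `D`s pop `U₂(s,i-1)` (frame for `i = 0`) and `U₁(s,i)`, so each interaction pair carries 4 indicator arcs (one per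
  bit pair) and the face is RIGID (its vertices are exactly the `2^{r²}` designed matchings).  i1's double-window
  layout (α/β windows) is NOT rigid — the two windows of a block carry independent bits (16 designed vs 500 supported
  vertices at m = k = 2; memo §8.2) — which is the repair this file records.
* `QueueGridPPHard` (IN PRINT modulo routine assembly, memo §8.4): `xc(queueGridPP r) ≥ 2^{Ω(r^{1/4})}`, hence above
  every threshold `2^{(log₂ r + c)^c}` eventually: `queueGridPP r ≅ COR(P_{r,r})` (affine, slack-form cost `+O(r⁴)`);
  `COR` is minor-monotone (deletion = coordinate projection, contraction of `uv` = the face `b_u = y_uv = b_v`) and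
  `STAB(H)` is the projection of the face `y ≡ 0` of `COR(H)`; `P_{r,r} ⊇ grid_{⌊r/2⌋}`; every planar `H` with
  `|V|+2|E| ≤ g` is a minor of the `2g × 2g` grid [Robertson–Seymour–Thomas 1994 (1.5)]; and there are cubic planar
  `H` on `O(n)` vertices with `xc(STAB(H)) ≥ 2^{Ω(n^{1/4})}` [Avis–Tiwary, Math. Prog. 153 (2015) = arXiv:1302.2340,
  Cor. 5; Cor. 4 for planar `O(n²)`-vertex graphs with `2^{Ω(√n)}`]; faces/projections: [FMPTW 2015 Lemma 9] = the tree's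
  `HasEFOfSize.inter_eqs` / `.image_comp`.
Net (LOCATED): `xc(NFP(2n)) ≥ 2^{Ω(n^{1/8})}`, so with Grochow's published circuit-to-EF bound (`MonotoneCircuitQuasiPolyEF`)
HD-1 and every singleton-class cofactor of ANY degree (memo §3 N2) follow; the RESIDUAL of memo §4 is untouched.
-/

namespace Summit.ValiantsHypothesis.ValiantsHypothesis.Cruxes.NNLinearDegreeCofactorHard.QueueGridFace

open Matrix MvPolynomial Literature.Computability.AlgebraicComplexity Literature.Barriers.PneNP Filter Topology
open Literature.Computability.MetaComplexity (gridGraph gridAdj)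
open Literature.Combinatorics.SimpleGraph (IsMinor)
open scoped NNReal

/-! ## Verbatim copies of the `NextRungDual` vocabulary (see the module docstring) -/

section Copies
variable {σ : Type}

/-- the exponent vector `d` as a real point [copy of `NextRungDual.realOf`] -/
def realOf (d : σ →₀ ℕ) : σ → ℝ := fun i => ((d i : ℕ) : ℝ)

/-- the support of `f` as a real point set [copy of `NextRungDual.suppPts`] -/
def suppPts (f : MvPolynomial σ ℝ≥0) : Set (σ → ℝ) := realOf '' (f.support : Set (σ →₀ ℕ))

/-- the Newton polytope `Newt(f) = conv(supp f)` [copy of `NextRungDual.newt`] -/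
def newt (f : MvPolynomial σ ℝ≥0) : Set (σ → ℝ) := convexHull ℝ (suppPts f)

end Copies

/-- **NFP-xc** = i1's K1 at `R = ∅`, quasi-polynomial form [copy of `NextRungDual.NFPolytopeQuasiPolyXC`]: every
extended formulation of `NFP(2n) = Newt(NN_n)` has more than `2^((log₂ n + c)^c)` inequalities, for every `c`,
eventually in `n`. -/
def NFPolytopeQuasiPolyXC : Prop :=
  ∀ c : ℕ, ∃ n₀ : ℕ, ∀ n ≥ n₀, ∀ r : ℕ,
    HasEFOfSize (newt (nestFreeMatchingPoly n ℝ≥0)) r → 2 ^ ((Nat.log 2 n + c) ^ c) < r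

/-! ## The pair-pattern polytope of the square queue grid -/

/-- blocks of the `r`-queue grid: `(s, i)` = stretch `s`, column `i` -/
abbrev QGV (r : ℕ) := Fin r × Fin r

/-- the ORDERED interaction pairs of layout B: `((s,i),(s+1,i))` and `((s,i),(s+1,i+1))` (window `(s+1,j)` pops
`U₂(s,j-1)` and `U₁(s,j)`); as a graph this is the grid sheared, `(s,i) ↦ (s-i, i)`. -/
def qgEdge (r : ℕ) (p : QGV r × QGV r) : Bool :=
  (p.2.1.val == p.1.1.val + 1) && (p.2.2.val == p.1.2.val || p.2.2.val == p.1.2.val + 1)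

/-- the pattern vector of a bit assignment `X`: coordinate `((u,v),(a,b))` is `1` iff `uv` is an interaction pair
and `(X u, X v) = (a, b)`; non-pairs carry `0` (in the gadget: the indicator arc of the bit pair, resp. a non-`E*` arc) -/
noncomputable def patternVec (r : ℕ) (X : QGV r → Bool) : (QGV r × QGV r) × Bool × Bool → ℝ :=
  fun q => if qgEdge r q.1 = true ∧ X q.1.1 = q.2.1 ∧ X q.1.2 = q.2.2 then 1 else 0

/-- the PAIR-PATTERN polytope `PP_r = conv{patternVec X}` of the `r × r` queue grid — affinely isomorphic to the
correlation (Boolean quadric) polytope `COR(P_{r,r}) = conv{(X, (X_u X_v)_{uv})}` via `y^{11} = y`,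
`y^{10} = b_u - y`, `y^{01} = b_v - y`, `y^{00} = 1 - b_u - b_v + y`. [folklore object; the name is ours] -/
noncomputable def queueGridPP (r : ℕ) : Set ((QGV r × QGV r) × Bool × Bool → ℝ) :=
  convexHull ℝ (Set.range (patternVec r))

/-- **Queue-grid face** (val-idea-7 g6; LOCATED — rigidity proof sketch memo §8.3, exhaustive check `r ≤ 4`):
for `r ≥ 1`, `n ≥ (r+1)(2r+1)`, some affine section of `NFP(2n) = Newt(NN_n)` (the coordinate face of the layout-B
support `E*`, padded by forced short arcs) maps by a coordinate restriction EXACTLY onto `PP_r`.  Stated with an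
arbitrary finite equation family (what `HasEFOfSize.inter_eqs` consumes); the gadget gives `x_e = 0 (e ∉ E*)`. -/
def QueueGridFaceProjection : Prop :=
  ∀ r n : ℕ, 1 ≤ r → (r + 1) * (2 * r + 1) ≤ n →
    ∃ (k : ℕ) (cv : Fin k → (Fin (2 * n) × Fin (2 * n) → ℝ)) (δ : Fin k → ℝ)
      (f : (QGV r × QGV r) × Bool × Bool → Fin (2 * n) × Fin (2 * n)),
      (fun x : (Fin (2 * n) × Fin (2 * n)) → ℝ => x ∘ f) ''
          (newt (nestFreeMatchingPoly n ℝ≥0) ∩ {x | ∀ t, cv t ⬝ᵥ x = δ t}) = queueGridPP r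

/-- **Grid pattern polytope is xc-hard** (IN PRINT modulo routine assembly — Avis–Tiwary 2015 Cor. 5 [arXiv:1302.2340]
+ Robertson–Seymour–Thomas 1994 (1.5) + minor-monotonicity of `COR` + `STAB(H)` = projection of the face `y ≡ 0` of
`COR(H)` + `PP_r ≅ COR(P_{r,r})`; true bound `2^{Ω(r^{1/4})}`, stated quasi-polynomially weakly): every slack-form EF
of `PP_r` has more than `2^{(log₂ r + c)^c}` inequalities, for every `c`, eventually in `r`. -/
def QueueGridPPHard : Prop :=
  ∀ c : ℕ, ∃ r₀ : ℕ, ∀ r ≥ r₀, ∀ t : ℕ, HasEFOfSize (queueGridPP r) t → 2 ^ ((Nat.log 2 r + c) ^ c) < t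

/-! ## (rev 2, g7) Input A split: 0/1 points (combinatorial heart) + faces of non-negative hulls (generic) -/

/-- **A1 — the 0/1 points of the queue-grid face** (val-idea-7 g6/g7; the COMBINATORIAL HEART of input A, proved on
paper for all `r` in memo §9 — layout-B rigidity by a FIFO window induction — and verified by exact memoised count
for all `r ≤ 7`, `sim/queue_grid_rigidity_memo.py`): for `r ≥ 1`, `n ≥ (r+1)(2r+1)` there are a finite set `Z` of
coordinates (the arcs outside `E* ∪ pad`) and a read-out map `f` (bit-pair `(uv,a,b)` ↦ the indicator arc
`e^{ab}_{uv}`, non-edges ↦ a never-used diagonal coordinate) such that the exponent vectors of `NN_n` vanishing on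
`Z` — i.e. the nest-free perfect matchings supported on `E* ∪ pad` — read through `f` are EXACTLY the pattern vectors
`patternVec r X`, `X : QGV r → Bool`.  No polytope, no extended formulation in the statement. -/
def QueueGridZeroOnePoints : Prop :=
  ∀ r n : ℕ, 1 ≤ r → (r + 1) * (2 * r + 1) ≤ n →
    ∃ (Z : Finset (Fin (2 * n) × Fin (2 * n)))
      (f : (QGV r × QGV r) × Bool × Bool → Fin (2 * n) × Fin (2 * n)),
      (fun x : (Fin (2 * n) × Fin (2 * n)) → ℝ => x ∘ f) ''
          (suppPts (nestFreeMatchingPoly n ℝ≥0) ∩ {x | ∀ e ∈ Z, x e = 0}) = Set.range (patternVec r)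

/-- **A2 — coordinate faces of hulls of non-negative point sets** (generic convexity, PROVED below as
`faceOfNonnegHull`): if every point of `S ⊆ ℝ^ι` is coordinatewise `≥ 0` then the face `{x_e = 0, e ∈ Z}` of
`conv S` is the hull of the points of `S` on it. [folklore: a face of a polytope cut out by a valid inequality
(`Σ_{e ∈ Z} x_e ≥ 0`) is the hull of the generators satisfying it with equality] -/
def FaceOfNonnegHull : Prop :=
  ∀ (ι : Type) (S : Set (ι → ℝ)) (Z : Finset ι), (∀ x ∈ S, ∀ i, 0 ≤ x i) →
    convexHull ℝ S ∩ {x | ∀ i ∈ Z, x i = 0} = convexHull ℝ (S ∩ {x | ∀ i ∈ Z, x i = 0})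

/-- A2 holds. [folklore] -/
theorem faceOfNonnegHull : FaceOfNonnegHull := by
  classical
  intro ι S Z hS
  apply Set.Subset.antisymm
  · rintro x ⟨hx, hxZ⟩
    rw [convexHull_eq] at hx
    obtain ⟨κ, t, w, z, hw0, hw1, hz, rfl⟩ := hx
    have hcm : t.centerMass w z = ∑ i ∈ t, w i • z i := Finset.centerMass_eq_of_sum_1 _ _ hw1
    have hzero : ∀ i ∈ t, w i ≠ 0 → ∀ e ∈ Z, z i e = 0 := by
      intro i hi hwi e he
      have h0 : (∑ j ∈ t, w j • z j) e = 0 := by rw [← hcm]; exact hxZ e he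
      rw [Finset.sum_apply] at h0
      simp only [Pi.smul_apply, smul_eq_mul] at h0
      have hterm := (Finset.sum_eq_zero_iff_of_nonneg
        (fun j hj => mul_nonneg (hw0 j hj) (hS _ (hz j hj) e))).mp h0 i hi
      rcases mul_eq_zero.mp hterm with h | h
      · exact absurd h hwi
      · exact h
    rw [← Finset.centerMass_filter_ne_zero]
    apply Finset.centerMass_mem_convexHull
    · intro i hi
      exact hw0 i (Finset.mem_filter.mp hi).1
    · rw [Finset.sum_filter_ne_zero, hw1]
      exact one_pos
    · intro i hi
      obtain ⟨hit, hwi⟩ := Finset.mem_filter.mp hi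
      exact ⟨hz i hit, fun e he => hzero i hit hwi e he⟩
  · apply Set.subset_inter (convexHull_mono Set.inter_subset_left)
    refine convexHull_min Set.inter_subset_right ?_
    intro a ha b hb s t _ _ _
    simp only [Set.mem_setOf_eq] at ha hb ⊢
    intro e he
    simp [ha e he, hb e he]

/-- the equation family `x_e = 0 (e ∈ Z)` in the `cv ⬝ᵥ x = δ` format consumed by `HasEFOfSize.inter_eqs`. -/
theorem setOf_single_dotProduct_eq {σ : Type} [Fintype σ] [DecidableEq σ] (Z : Finset σ) :
    {x : σ → ℝ | ∀ t : Fin Z.card, (Pi.single ((Z.equivFin.symm t : Z) : σ) (1 : ℝ)) ⬝ᵥ x = 0} =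
      {x | ∀ e ∈ Z, x e = 0} := by
  ext x
  simp only [Set.mem_setOf_eq]
  constructor
  · intro h e he
    have := h (Z.equivFin ⟨e, he⟩)
    rwa [Equiv.symm_apply_apply, dotProduct_comm, dotProduct_single, mul_one] at this
  · intro h t
    rw [dotProduct_comm, dotProduct_single, mul_one]
    exact h _ (Z.equivFin.symm t).2

/-- **Input A from A1 + A2** (kernel-checked): the coordinate face `{x_e = 0, e ∈ Z}` of `NFP(2n) = conv(suppPts NN_n)`
is the hull of the supported 0/1 points (A2, exponent vectors are `≥ 0`), a linear read-out commutes with `conv`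
(`LinearMap.image_convexHull`), and the read-out of the supported points is `range (patternVec r)` (A1); its hull is
`queueGridPP r` by definition. [folklore assembly] -/
theorem queueGridFaceProjection_of_points (hA : QueueGridZeroOnePoints) (hB : FaceOfNonnegHull) :
    QueueGridFaceProjection := by
  classical
  intro r n hr hn
  obtain ⟨Z, f, hZf⟩ := hA r n hr hn
  refine ⟨Z.card, fun t => Pi.single ((Z.equivFin.symm t : Z) : Fin (2 * n) × Fin (2 * n)) 1,
    fun _ => 0, f, ?_⟩
  rw [setOf_single_dotProduct_eq Z]
  have hS : ∀ x ∈ suppPts (nestFreeMatchingPoly n ℝ≥0), ∀ i, 0 ≤ x i := by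
    rintro _ ⟨d, -, rfl⟩ i
    exact Nat.cast_nonneg _
  rw [newt, hB _ _ Z hS]
  have hlin : (fun x : (Fin (2 * n) × Fin (2 * n)) → ℝ => x ∘ f) =
      ⇑(LinearMap.funLeft ℝ ℝ f : ((Fin (2 * n) × Fin (2 * n)) → ℝ) →ₗ[ℝ] _) := by
    funext x; rfl
  rw [hlin, LinearMap.image_convexHull, ← hlin, hZf, queueGridPP]

/-! ## The assembly (kernel-checked) -/

/-- Newton polytopes live in the nonnegative orthant (exponents are naturals). [folklore] -/
theorem newt_nonneg {σ : Type} (f : MvPolynomial σ ℝ≥0) (x : σ → ℝ) (hx : x ∈ newt f) (i : σ) : 0 ≤ x i := by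
  have hsub : suppPts f ⊆ Set.univ.pi (fun _ : σ => Set.Ici (0 : ℝ)) := by
    rintro _ ⟨d, -, rfl⟩
    simp only [Set.mem_univ_pi, Set.mem_Ici]
    intro j
    exact Nat.cast_nonneg _
  have hx' := convexHull_min hsub (convex_pi fun _ _ => convex_Ici (0 : ℝ)) hx
  exact Set.mem_univ_pi.mp hx' i

/-- arithmetic: the quasi-polynomial thresholds in `n` sit below those in the grid side `r ≈ √(n/2)`, with room for
the additive `4n²` of the slack-form projection. -/
theorem grid_threshold_room (lam c ℓ : ℕ) (hℓ : ℓ ≤ 2 * lam + 5) :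
    (ℓ + c) ^ c + (2 * ℓ + 5) ≤ (lam + (2 * c + 4)) ^ (2 * c + 4) := by
  have hB : (ℓ + c) ^ c ≤ (lam + (2 * c + 4)) ^ (2 * c) := by
    calc (ℓ + c) ^ c ≤ (2 * (lam + c + 3)) ^ c := Nat.pow_le_pow_left (by omega) c
      _ = 2 ^ c * (lam + c + 3) ^ c := by rw [mul_pow]
      _ ≤ (lam + c + 3) ^ c * (lam + c + 3) ^ c :=
          Nat.mul_le_mul_right _ (Nat.pow_le_pow_left (by omega) c)
      _ = (lam + c + 3) ^ (2 * c) := by rw [← pow_add, two_mul]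
      _ ≤ (lam + (2 * c + 4)) ^ (2 * c) := Nat.pow_le_pow_left (by omega) _
  have hD : 4 * lam + 16 ≤ (lam + (2 * c + 4)) ^ 4 := by
    have h64 : 4 ^ 3 ≤ (lam + (2 * c + 4)) ^ 3 := Nat.pow_le_pow_left (by omega) 3
    calc 4 * lam + 16 = (lam + 4) * 4 := by ring
      _ ≤ (lam + (2 * c + 4)) * (lam + (2 * c + 4)) ^ 3 := Nat.mul_le_mul (by omega) (by omega)
      _ = (lam + (2 * c + 4)) ^ 4 := by ring
  have hB1 : 1 ≤ (ℓ + c) ^ c := by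
    rcases c with _ | c
    · simp
    · exact Nat.one_le_pow _ _ (by omega)
  calc (ℓ + c) ^ c + (2 * ℓ + 5) ≤ (ℓ + c) ^ c + (ℓ + c) ^ c * (4 * lam + 15) := by nlinarith
    _ = (ℓ + c) ^ c * (4 * lam + 16) := by ring
    _ ≤ (lam + (2 * c + 4)) ^ (2 * c) * (lam + (2 * c + 4)) ^ 4 := Nat.mul_le_mul hB hD
    _ = (lam + (2 * c + 4)) ^ (2 * c + 4) := by rw [← pow_add]

/-- **K1 ⇐ queue-grid face ∧ grid pattern-polytope bound.**  For `n` large take `r = ⌊√n⌋/2 - 1`, so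
`(r+1)(2r+1) ≤ n`; an EF of `NFP(2n)` of size `t` restricts to the face (`inter_eqs`, size `t`) and projects to
`PP_r` (`image_comp`, size `4n² + t`); the grid bound at `c' = 2c + 4` beats `2^{(log₂ n + c)^c} + 4n²` because
`log₂ n ≤ 2 log₂ r + 5`. [folklore assembly; inputs: `QueueGridFaceProjection` (this seat), `QueueGridPPHard` (print)] -/
theorem nfp_xc_of_queueGrid (hF : QueueGridFaceProjection) (hG : QueueGridPPHard) :
    NFPolytopeQuasiPolyXC := by
  classical
  intro c
  obtain ⟨r₀, hr₀⟩ := hG (2 * c + 4)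
  refine ⟨(2 * r₀ + 4) ^ 2, fun n hn t hEF => ?_⟩
  -- the grid side `r`
  set q := Nat.sqrt n with hq
  have hq4 : 2 * r₀ + 4 ≤ q := by
    rw [hq, Nat.le_sqrt']
    exact hn
  set r := q / 2 - 1 with hr
  have hr1 : 1 ≤ r := by omega
  have hr₀r : r₀ ≤ r := by omega
  have hrn : (r + 1) * (2 * r + 1) ≤ n := by
    have h1 : r + 1 ≤ q := by omega
    have h2 : 2 * r + 1 ≤ q := by omega
    have h3 : q * q ≤ n := by rw [hq]; exact Nat.sqrt_le n
    exact (Nat.mul_le_mul h1 h2).trans h3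
  -- face + projection
  obtain ⟨k, cv, δ, f, hface⟩ := hF r n hr1 hrn
  have h1 := hEF.inter_eqs cv δ
  have h2 := h1.image_comp (fun x hx => newt_nonneg _ x hx.1) f
  rw [hface, Fintype.card_prod, Fintype.card_fin] at h2
  have h3 := hr₀ r hr₀r _ h2
  -- logarithms: `log₂ n ≤ 2 log₂ r + 5`
  set ℓ := Nat.log 2 n with hℓ
  set lam := Nat.log 2 r with hlam
  have h16 : 16 ≤ (2 * r₀ + 4) ^ 2 := by nlinarith
  have hn0 : n ≠ 0 := by omega
  have hrlt : r < 2 ^ (lam + 1) := Nat.lt_pow_succ_log_self one_lt_two r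
  have hnlt : n < 2 ^ (ℓ + 1) := Nat.lt_pow_succ_log_self one_lt_two n
  have hqr : q ≤ 2 * r + 3 := by omega
  have hn_q : n < (q + 1) * (q + 1) := by
    have := Nat.lt_succ_sqrt n
    rw [← hq] at this
    simpa [Nat.succ_eq_add_one] using this
  have hX2 : 2 ≤ 2 ^ (lam + 1) := by
    calc (2 : ℕ) = 2 ^ 1 := by norm_num
      _ ≤ 2 ^ (lam + 1) := Nat.pow_le_pow_right (by norm_num) (by omega)
  have hpow : 2 ^ (lam + 3) = 4 * 2 ^ (lam + 1) := by
    rw [show lam + 3 = lam + 1 + 2 by omega, pow_add]; ring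
  have hq2 : q + 1 ≤ 2 ^ (lam + 3) := by
    rw [hpow]
    generalize hX : 2 ^ (lam + 1) = X at hrlt hX2
    omega
  have hn2 : n < 2 ^ (2 * lam + 6) := by
    calc n < (q + 1) * (q + 1) := hn_q
      _ ≤ 2 ^ (lam + 3) * 2 ^ (lam + 3) := Nat.mul_le_mul hq2 hq2
      _ = 2 ^ (2 * lam + 6) := by rw [← pow_add]; ring_nf
  have hℓlam : ℓ ≤ 2 * lam + 5 := by
    have := Nat.log_lt_of_lt_pow hn0 hn2
    omega
  have hroom := grid_threshold_room lam c ℓ hℓlam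
  -- `4 n² ≤ 2^(2ℓ+4)`
  have hn4 : 2 * n * (2 * n) ≤ 2 ^ (2 * ℓ + 4) := by
    have hle : n ≤ 2 ^ (ℓ + 1) := hnlt.le
    calc 2 * n * (2 * n) = 4 * (n * n) := by ring
      _ ≤ 4 * (2 ^ (ℓ + 1) * 2 ^ (ℓ + 1)) := Nat.mul_le_mul_left 4 (Nat.mul_le_mul hle hle)
      _ = 2 ^ (2 * ℓ + 4) := by ring
  -- conclude: 2^B + 4n² ≤ 2^A < 4n² + t
  set A := (lam + (2 * c + 4)) ^ (2 * c + 4) with hA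
  set B := (ℓ + c) ^ c with hB
  obtain ⟨A', hA'⟩ : ∃ A', A = A' + 1 := ⟨A - 1, by omega⟩
  have hBA : 2 ^ B ≤ 2 ^ A' := Nat.pow_le_pow_right (by norm_num) (by omega)
  have hLA : 2 ^ (2 * ℓ + 4) ≤ 2 ^ A' := Nat.pow_le_pow_right (by norm_num) (by omega)
  have h2A : 2 ^ A = 2 ^ A' + 2 ^ A' := by rw [hA', pow_succ]; ring
  have h3' : 2 ^ A < 2 * n * (2 * n) + t := h3
  generalize hM : 2 * n * (2 * n) = M at h3' hn4
  generalize hPB : 2 ^ B = PB at hBA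
  generalize hPA : 2 ^ A = PA at h2A h3'
  generalize hPA' : 2 ^ A' = PA' at hBA hLA h2A
  generalize hPL : 2 ^ (2 * ℓ + 4) = PL at hLA hn4
  omega


/-! ## By name: the route item K1 (stmt-ValiantsHypothesis-26254), and the LINE skeleton (rev 2)

`Theses.FifoMatching` rev 9 inlines `NN_n` (definitionally `nestFreeMatchingPoly n ℝ≥0`) and `Newt` verbatim, so the
route decl is a definitional re-typing of this file's `NFPolytopeQuasiPolyXC` (checked: the terms below elaborate). -/

/-- **K1 by name from the two g6 inputs.** [assembly] -/
theorem k1_of_queueGrid (hF : QueueGridFaceProjection) (hG : QueueGridPPHard) :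
    Summit.ValiantsHypothesis.ValiantsHypothesis.Theses.FifoMatching.NFPolytopeQuasiPolyXC :=
  nfp_xc_of_queueGrid hF hG

/-- **The line's composition** `K1 ⇐ A1 ∧ B` (A2 is proved): kernel-checked, no `sorry`. [assembly] -/
theorem NFPolytopeQuasiPolyXC_of (hA : QueueGridZeroOnePoints) (hG : QueueGridPPHard) :
    Summit.ValiantsHypothesis.ValiantsHypothesis.Theses.FifoMatching.NFPolytopeQuasiPolyXC :=
  nfp_xc_of_queueGrid (queueGridFaceProjection_of_points hA faceOfNonnegHull) hG

/-! # §B♯ (rev 3): input B from ONE print fact — AFHMS 2019, Theorem 6 at the grid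

Verbatim the published workfile `Lines/queue_grid_face_bsharp.lean` rev 2 (minus its vocabulary copies). -/

noncomputable section

/-! ## Correlation polytope of a graph; the AFHMS 2019 grid fact (local copy) -/

/-- the COR-vertex of a bit vector `b`: coordinate `(v,v)` carries `b_v`, an adjacent pair `(u,v)` carries
`b_u b_v` (both orientations), non-adjacent off-diagonal coordinates are masked to `0`.
[cite: AboulkerEtAl2019, §2 proof of Thm 1 (p. 4): "COR(G) is the convex hull of all 0/1-vectors x ∈ ℝ^{V ∪ E}
satisfying x_{uv} = x_u x_v for all uv ∈ E(G)"] -/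
def corVertex {V : Type} [DecidableEq V] (G : SimpleGraph V) [DecidableRel G.Adj] (b : V → Bool) :
    V × V → ℝ :=
  fun p => if p.1 = p.2 then (if b p.1 = true then 1 else 0)
    else if G.Adj p.1 p.2 then (if b p.1 = true ∧ b p.2 = true then 1 else 0) else 0

/-- `COR(G)` in masked `V × V` coordinates -/
def corPolytopeGraph {V : Type} [DecidableEq V] (G : SimpleGraph V) [DecidableRel G.Adj] : Set (V × V → ℝ) :=
  convexHull ℝ (Set.range (corVertex G))

/-- **AFHMS 2019 at the grid** (LOCAL COPY of the requested Literature fact): `xc(COR(G_{t,t})) ≥ 2^{c t}`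
eventually, slack-form currency. [cite: AboulkerEtAl2019, Theorem 6 (p. 5) with 𝒞 = planar, G = G_{t,t},
tw(G_{t,t}) = t; remark after Theorem 3 (p. 4)] -/
def AFHMS2019Grid : Prop :=
  ∃ c : ℝ, 0 < c ∧ ∀ᶠ t : ℕ in atTop, ∀ R : ℕ,
    HasEFOfSize (corPolytopeGraph (gridGraph t)) R → (2 : ℝ) ^ (c * t) ≤ R

/-- **AFHMS 2019, grid-minor form** (LOCAL COPY of the G-general typing ruled in R147 (a) for the Literature module
`CorrelationPolytopeGridMinor`: the `log n` term of the printed remark dropped = a weakening of print): a graph with a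
`G_{h,h}` minor has `xc(COR(G)) ≥ 2^{c h}`. [cite: AboulkerEtAl2019, remark after Theorem 3 (p. 4 L1) «for every graph G,
we have xc(COR(G)) ≥ 2^{Ω(h + log n)}, where h is the maximum height of a grid that G contains as a minor»; Theorem 6
(p. 5); Observation 5 (p. 5, COR is minor-monotone)] -/
def AFHMS2019GridMinor : Prop :=
  ∃ c : ℝ, 0 < c ∧ ∀ h : ℕ, 1 ≤ h →
    ∀ (β : Type) [Fintype β] [DecidableEq β] (G : SimpleGraph β) [DecidableRel G.Adj],
      IsMinor (gridGraph h) G → ∀ R : ℕ, HasEFOfSize (corPolytopeGraph G) R → (2 : ℝ) ^ (c * h) ≤ R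

/-- the grid-only instance from the grid-minor form (`IsMinor.refl`, one line) -/
theorem afhms2019Grid_of_gridMinor (hM : AFHMS2019GridMinor) : AFHMS2019Grid := by
  obtain ⟨c, hc, h⟩ := hM
  exact ⟨c, hc, Filter.eventually_atTop.mpr ⟨1, fun t ht R hR => h t ht _ (gridGraph t) (IsMinor.refl _) R hR⟩⟩

/-! ## (g1) the grid inside the queue grid -/

theorem grid_index_bounds {g : ℕ} (a : Fin (g * g)) : 0 < g ∧ a.val / g < g ∧ a.val % g < g := by
  have h0 : 0 < g := Nat.pos_of_ne_zero (fun h => by subst h; exact absurd a.isLt (by simp))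
  refine ⟨h0, ?_, Nat.mod_lt _ h0⟩
  exact (Nat.div_lt_iff_lt_mul h0).mpr a.isLt

/-- grid vertex `a` (row `a / g`, column `a % g`) ↦ queue-grid block `(row + col, col)` -/
def phi (r g : ℕ) (hg : 2 * g ≤ r) (a : Fin (g * g)) : QGV r :=
  (⟨a.val / g + a.val % g, by have := grid_index_bounds a; omega⟩,
   ⟨a.val % g, by have := grid_index_bounds a; omega⟩)

/-- the V-type out-neighbour `(row + col + 1, col)` of `phi a` (exists since `row + col ≤ 2g - 2 ≤ r - 2`) -/
def phiS (r g : ℕ) (hg : 2 * g ≤ r) (a : Fin (g * g)) : QGV r :=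
  (⟨a.val / g + a.val % g + 1, by have := grid_index_bounds a; omega⟩,
   ⟨a.val % g, by have := grid_index_bounds a; omega⟩)

theorem phi_injective (r g : ℕ) (hg : 2 * g ≤ r) : Function.Injective (phi r g hg) := by
  intro a b h
  simp only [phi, Prod.mk.injEq, Fin.mk.injEq] at h
  apply Fin.ext
  have ha := Nat.div_add_mod a.val g
  have hb := Nat.div_add_mod b.val g
  have h1 : a.val / g = b.val / g := by omega
  have h2 : a.val % g = b.val % g := h.2
  calc a.val = g * (a.val / g) + a.val % g := ha.symm
    _ = g * (b.val / g) + b.val % g := by rw [h1, h2]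
    _ = b.val := hb

theorem qgEdge_iff (r : ℕ) (p : QGV r × QGV r) :
    qgEdge r p = true ↔ p.2.1.val = p.1.1.val + 1 ∧ (p.2.2.val = p.1.2.val ∨ p.2.2.val = p.1.2.val + 1) := by
  simp [qgEdge, Bool.and_eq_true, Bool.or_eq_true, beq_iff_eq]

theorem qgEdge_phi_phiS (r g : ℕ) (hg : 2 * g ≤ r) (a : Fin (g * g)) :
    qgEdge r (phi r g hg a, phiS r g hg a) = true := by
  rw [qgEdge_iff]; exact ⟨rfl, Or.inl rfl⟩

/-- a grid edge is a queue-grid pair in exactly one orientation -/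
theorem qgEdge_of_gridAdj (r g : ℕ) (hg : 2 * g ≤ r) (a b : Fin (g * g)) (h : (gridGraph g).Adj a b) :
    (qgEdge r (phi r g hg a, phi r g hg b) = true ∧ qgEdge r (phi r g hg b, phi r g hg a) = false) ∨
    (qgEdge r (phi r g hg a, phi r g hg b) = false ∧ qgEdge r (phi r g hg b, phi r g hg a) = true) := by
  have key :
      ((b.val / g + b.val % g = a.val / g + a.val % g + 1 ∧ (b.val % g = a.val % g ∨ b.val % g = a.val % g + 1)) ∧
        ¬ (a.val / g + a.val % g = b.val / g + b.val % g + 1 ∧ (a.val % g = b.val % g ∨ a.val % g = b.val % g + 1))) ∨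
      (¬ (b.val / g + b.val % g = a.val / g + a.val % g + 1 ∧ (b.val % g = a.val % g ∨ b.val % g = a.val % g + 1)) ∧
        (a.val / g + a.val % g = b.val / g + b.val % g + 1 ∧ (a.val % g = b.val % g ∨ a.val % g = b.val % g + 1))) := by
    change gridAdj g a b at h
    unfold gridAdj at h
    omega
  have e1 : qgEdge r (phi r g hg a, phi r g hg b) = true ↔
      (b.val / g + b.val % g = a.val / g + a.val % g + 1 ∧ (b.val % g = a.val % g ∨ b.val % g = a.val % g + 1)) :=
    qgEdge_iff r _
  have e2 : qgEdge r (phi r g hg b, phi r g hg a) = true ↔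
      (a.val / g + a.val % g = b.val / g + b.val % g + 1 ∧ (a.val % g = b.val % g ∨ a.val % g = b.val % g + 1)) :=
    qgEdge_iff r _
  rcases key with ⟨hA, hB⟩ | ⟨hA, hB⟩
  · left
    refine ⟨e1.mpr hA, ?_⟩
    simpa using (show ¬ (qgEdge r (phi r g hg b, phi r g hg a) = true) from fun hh => hB (e2.mp hh))
  · right
    refine ⟨?_, e2.mpr hB⟩
    simpa using (show ¬ (qgEdge r (phi r g hg a, phi r g hg b) = true) from fun hh => hA (e1.mp hh))

/-! ## (g2) the linear read-out `PP_r ↠ COR(G_{g,g})` -/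

/-- the read-out functional: `b_a := p^{1,0} + p^{1,1}` of the out-pair of `phi a`; `y_{ab} := p^{1,1}` of
whichever orientation of `(phi a, phi b)` is a queue-grid pair (the other coordinate is `0` on `PP_r`); else `0`. -/
def corFun (r g : ℕ) (hg : 2 * g ≤ r) (x : (QGV r × QGV r) × Bool × Bool → ℝ)
    (p : Fin (g * g) × Fin (g * g)) : ℝ :=
  if p.1 = p.2 then
    x ((phi r g hg p.1, phiS r g hg p.1), (true, false)) + x ((phi r g hg p.1, phiS r g hg p.1), (true, true))
  else if (gridGraph g).Adj p.1 p.2 then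
    x ((phi r g hg p.1, phi r g hg p.2), (true, true)) + x ((phi r g hg p.2, phi r g hg p.1), (true, true))
  else 0

/-- `corFun` as a linear map -/
def corMap (r g : ℕ) (hg : 2 * g ≤ r) :
    ((QGV r × QGV r) × Bool × Bool → ℝ) →ₗ[ℝ] (Fin (g * g) × Fin (g * g) → ℝ) where
  toFun := corFun r g hg
  map_add' x y := by
    funext p
    simp only [corFun, Pi.add_apply]
    split_ifs <;> ring
  map_smul' a x := by
    funext p
    simp only [corFun, Pi.smul_apply, smul_eq_mul, RingHom.id_apply]
    split_ifs <;> ring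

theorem corMap_apply (r g : ℕ) (hg : 2 * g ≤ r) (x : (QGV r × QGV r) × Bool × Bool → ℝ)
    (p : Fin (g * g) × Fin (g * g)) : corMap r g hg x p = corFun r g hg x p := rfl

/-- the read-out of a pattern vector is the COR-vertex of the restricted bit vector -/
theorem corMap_patternVec (r g : ℕ) (hg : 2 * g ≤ r) (X : QGV r → Bool) :
    corMap r g hg (patternVec r X) = corVertex (gridGraph g) (X ∘ phi r g hg) := by
  funext p
  obtain ⟨a, b⟩ := p
  rw [corMap_apply]
  by_cases hab : a = b
  · subst hab
    have hq := qgEdge_phi_phiS r g hg a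
    cases hXa : X (phi r g hg a) <;> cases hXs : X (phiS r g hg a) <;>
      simp [corFun, corVertex, patternVec, hq, hXa, hXs]
  · by_cases hadj : (gridGraph g).Adj a b
    · rcases qgEdge_of_gridAdj r g hg a b hadj with ⟨h1, h2⟩ | ⟨h1, h2⟩ <;>
        cases hXa : X (phi r g hg a) <;> cases hXb : X (phi r g hg b) <;>
          simp [corFun, corVertex, patternVec, hab, hadj, h1, h2, hXa, hXb]
    · simp [corFun, corVertex, hab, hadj]

/-- every bit vector of the grid lifts along `phi` -/
def liftBits (r g : ℕ) (hg : 2 * g ≤ r) (b : Fin (g * g) → Bool) : QGV r → Bool :=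
  fun v => if h : ∃ a, phi r g hg a = v then b h.choose else false

theorem liftBits_phi (r g : ℕ) (hg : 2 * g ≤ r) (b : Fin (g * g) → Bool) (a : Fin (g * g)) :
    liftBits r g hg b (phi r g hg a) = b a := by
  have h : ∃ a', phi r g hg a' = phi r g hg a := ⟨a, rfl⟩
  show (if h : ∃ a', phi r g hg a' = phi r g hg a then b h.choose else false) = b a
  rw [dif_pos h]
  exact congrArg b (phi_injective r g hg h.choose_spec)

theorem range_corMap_patternVec (r g : ℕ) (hg : 2 * g ≤ r) :
    Set.range (fun X => corMap r g hg (patternVec r X)) = Set.range (corVertex (gridGraph g)) := by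
  ext y
  constructor
  · rintro ⟨X, rfl⟩
    exact ⟨X ∘ phi r g hg, (corMap_patternVec r g hg X).symm⟩
  · rintro ⟨b, rfl⟩
    refine ⟨liftBits r g hg b, ?_⟩
    show corMap r g hg (patternVec r (liftBits r g hg b)) = corVertex (gridGraph g) b
    rw [corMap_patternVec]
    congr 1
    funext a
    exact liftBits_phi r g hg b a

/-- **(g2)** `COR(G_{g,g})` is a coordinate-linear image of the pair-pattern polytope `PP_r`, `2g ≤ r`. -/
theorem corMap_image_queueGridPP (r g : ℕ) (hg : 2 * g ≤ r) :
    corMap r g hg '' queueGridPP r = corPolytopeGraph (gridGraph g) := by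
  unfold queueGridPP corPolytopeGraph
  rw [LinearMap.image_convexHull, ← Set.range_comp,
    show Set.range (⇑(corMap r g hg) ∘ patternVec r) = Set.range (corVertex (gridGraph g)) from
      range_corMap_patternVec r g hg]

theorem queueGridPP_nonneg (r : ℕ) (x : (QGV r × QGV r) × Bool × Bool → ℝ) (hx : x ∈ queueGridPP r)
    (i : (QGV r × QGV r) × Bool × Bool) : 0 ≤ x i := by
  have hsub : Set.range (patternVec r) ⊆ Set.univ.pi (fun _ => Set.Ici (0 : ℝ)) := by
    rintro _ ⟨X, rfl⟩
    simp only [Set.mem_univ_pi, Set.mem_Ici]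
    intro j
    unfold patternVec
    split_ifs <;> norm_num
  have hx' := convexHull_min hsub (convex_pi fun _ _ => convex_Ici (0 : ℝ)) hx
  exact Set.mem_univ_pi.mp hx' i

/-- **(g2)+(g3)** an EF of `PP_r` with `t` inequalities gives one of `COR(G_{g,g})` with `4r⁴ + t`. -/
theorem hasEFOfSize_cor_of_pp (r g : ℕ) (hg : 2 * g ≤ r) (t : ℕ) (h : HasEFOfSize (queueGridPP r) t) :
    HasEFOfSize (corPolytopeGraph (gridGraph g)) (Fintype.card ((QGV r × QGV r) × Bool × Bool) + t) := by
  rw [← corMap_image_queueGridPP r g hg]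
  exact h.image_linear (queueGridPP_nonneg r) (corMap r g hg)

theorem card_patternIndex (r : ℕ) : Fintype.card ((QGV r × QGV r) × Bool × Bool) = 4 * r ^ 4 := by
  simp only [QGV, Fintype.card_prod, Fintype.card_fin, Fintype.card_bool]
  ring

/-! ## (g3) growth: quasi-polynomial + polynomial < exponential in `⌊r/2⌋`, eventually -/

/-- polynomial versus exponential, the one analytic input (`n^k / 2^n → 0`) -/
theorem poly_le_exp_eventually (c₀ : ℕ) {c : ℝ} (hc : 0 < c) :
    ∃ K : ℕ, 1 ≤ K ∧ ∀ k ≥ K, (((k + c₀) ^ c₀ + 4 * k + 7 : ℕ) : ℝ) ≤ c * 2 ^ (k - 1) := by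
  have h1 : Tendsto (fun k : ℕ => (((k + c₀ : ℕ) : ℝ)) ^ c₀ / 2 ^ (k + c₀)) atTop (𝓝 0) :=
    (tendsto_pow_const_div_const_pow_of_one_lt c₀ (one_lt_two : (1 : ℝ) < 2)).comp (tendsto_add_atTop_nat c₀)
  have h2 : Tendsto (fun k : ℕ => ((k : ℕ) : ℝ) ^ 1 / 2 ^ k) atTop (𝓝 0) :=
    tendsto_pow_const_div_const_pow_of_one_lt 1 (one_lt_two : (1 : ℝ) < 2)
  have hε₁ : (0 : ℝ) < c / 4 / 2 ^ c₀ := by positivity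
  have hε₂ : (0 : ℝ) < c / 4 / 11 := by positivity
  have e1 := h1.eventually (gt_mem_nhds hε₁)
  have e2 := h2.eventually (gt_mem_nhds hε₂)
  obtain ⟨K, hK⟩ := Filter.eventually_atTop.mp (e1.and e2)
  refine ⟨max K 1, le_max_right _ _, fun k hk => ?_⟩
  have hkK : K ≤ k := le_trans (le_max_left _ _) hk
  have hk1 : 1 ≤ k := le_trans (le_max_right _ _) hk
  obtain ⟨hA, hB⟩ := hK k hkK
  have h2pos : (0 : ℝ) < 2 ^ (k + c₀) := by positivity
  have h2pos' : (0 : ℝ) < 2 ^ k := by positivity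
  have hA1 : (((k + c₀ : ℕ) : ℝ)) ^ c₀ / 2 ^ (k + c₀) < c / 4 / 2 ^ c₀ := hA
  have hB1 : ((k : ℕ) : ℝ) ^ 1 / 2 ^ k < c / 4 / 11 := hB
  have hA' : (((k + c₀ : ℕ) : ℝ)) ^ c₀ < c / 4 / 2 ^ c₀ * 2 ^ (k + c₀) := (div_lt_iff₀ h2pos).mp hA1
  have hB' : ((k : ℕ) : ℝ) ^ 1 < c / 4 / 11 * 2 ^ k := (div_lt_iff₀ h2pos').mp hB1
  have hsplit : (2 : ℝ) ^ (k + c₀) = 2 ^ k * 2 ^ c₀ := pow_add 2 k c₀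
  have hc₀pos : (0 : ℝ) < 2 ^ c₀ := by positivity
  have hA'' : (((k + c₀ : ℕ) : ℝ)) ^ c₀ < c / 4 * 2 ^ k := by
    calc (((k + c₀ : ℕ) : ℝ)) ^ c₀ < c / 4 / 2 ^ c₀ * 2 ^ (k + c₀) := hA'
      _ = c / 4 * 2 ^ k := by
          rw [hsplit, mul_comm ((2 : ℝ) ^ k) (2 ^ c₀), ← mul_assoc, div_mul_cancel₀ _ hc₀pos.ne']
  have hB'' : ((k : ℕ) : ℝ) < c / 4 / 11 * 2 ^ k := by rw [pow_one] at hB'; exact hB'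
  obtain ⟨j, rfl⟩ : ∃ j, k = j + 1 := ⟨k - 1, by omega⟩
  simp only [Nat.add_sub_cancel]
  have hpow : (2 : ℝ) ^ (j + 1) = 2 * 2 ^ j := by rw [pow_succ]; ring
  rw [hpow] at hA'' hB''
  have hcast : (((j + 1 + c₀) ^ c₀ + 4 * (j + 1) + 7 : ℕ) : ℝ)
      = (((j + 1 + c₀ : ℕ) : ℝ)) ^ c₀ + 4 * ((j + 1 : ℕ) : ℝ) + 7 := by push_cast; ring
  rw [hcast]
  have hj1 : (1 : ℝ) ≤ ((j + 1 : ℕ) : ℝ) := by exact_mod_cast hk1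
  linarith [hA'', hB'', hj1, h2pos']

/-- the growth estimate the glue needs: `2^{(log₂ r + c₀)^{c₀}} + 4 r⁴ < 2^{c ⌊r/2⌋}` for `r ≥ r₀(c₀, c)` -/
theorem growth_eventually (c₀ : ℕ) {c : ℝ} (hc : 0 < c) :
    ∃ r₀ : ℕ, 2 ≤ r₀ ∧ ∀ r ≥ r₀,
      (2 : ℝ) ^ ((Nat.log 2 r + c₀) ^ c₀) + 4 * (r : ℝ) ^ 4 < (2 : ℝ) ^ (c * ((r / 2 : ℕ) : ℝ)) := by
  obtain ⟨K, hK1, hK⟩ := poly_le_exp_eventually c₀ hc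
  refine ⟨2 ^ K, ?_, fun r hr => ?_⟩
  · calc 2 = 2 ^ 1 := by norm_num
      _ ≤ 2 ^ K := Nat.pow_le_pow_right (by norm_num) hK1
  set k := Nat.log 2 r with hk
  have hr0 : r ≠ 0 := by
    have : 0 < 2 ^ K := Nat.two_pow_pos K
    omega
  have hlow : 2 ^ k ≤ r := Nat.pow_log_le_self 2 hr0
  have hup : r < 2 ^ (k + 1) := Nat.lt_pow_succ_log_self (by norm_num) r
  have hKk : K ≤ k := by
    by_contra hlt
    push Not at hlt
    have : 2 ^ (k + 1) ≤ 2 ^ K := Nat.pow_le_pow_right (by norm_num) hlt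
    omega
  have hk1 : 1 ≤ k := le_trans hK1 hKk
  -- g = ⌊r/2⌋ ≥ 2^(k-1)
  have hg : 2 ^ (k - 1) ≤ r / 2 := by
    have h2 : 2 ^ k = 2 * 2 ^ (k - 1) := by
      obtain ⟨j, hj⟩ : ∃ j, k = j + 1 := ⟨k - 1, by omega⟩
      rw [hj, pow_succ, Nat.add_sub_cancel]; ring
    omega
  have hpoly := hK k hKk
  -- natural-number packaging of the two summands below one power of two
  set q := (k + c₀) ^ c₀ with hq
  set E := q + 4 * k + 6 with hE
  have hN : 2 ^ q + 2 ^ (4 * k + 6) ≤ 2 ^ (E + 1) := by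
    have h1 : 2 ^ q ≤ 2 ^ E := Nat.pow_le_pow_right (by norm_num) (by omega)
    have h2 : 2 ^ (4 * k + 6) ≤ 2 ^ E := Nat.pow_le_pow_right (by norm_num) (by omega)
    have h3 : 2 ^ (E + 1) = 2 ^ E + 2 ^ E := by rw [pow_succ]; ring
    omega
  have hr4nat : 4 * r ^ 4 < 2 ^ (4 * k + 6) := by
    have h4 : r ^ 4 < (2 ^ (k + 1)) ^ 4 := Nat.pow_lt_pow_left hup (by norm_num)
    have h5 : (2 ^ (k + 1)) ^ 4 = 2 ^ (4 * k + 4) := by rw [← pow_mul]; ring_nf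
    have h6 : 2 ^ (4 * k + 6) = 4 * 2 ^ (4 * k + 4) := by
      rw [show 4 * k + 6 = (4 * k + 4) + 2 by ring, pow_add]; ring
    rw [h5] at h4
    rw [h6]
    omega
  have hr4 : 4 * (r : ℝ) ^ 4 < (2 : ℝ) ^ (4 * k + 6) := by exact_mod_cast hr4nat
  have hN' : (2 : ℝ) ^ q + (2 : ℝ) ^ (4 * k + 6) ≤ (2 : ℝ) ^ (E + 1) := by exact_mod_cast hN
  -- the exponent comparison `E + 1 ≤ c * g`
  have hexp : ((E + 1 : ℕ) : ℝ) ≤ c * ((r / 2 : ℕ) : ℝ) := by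
    have hE0 : E + 1 = (k + c₀) ^ c₀ + 4 * k + 7 := by rw [hE, hq]
    have hE' : ((E + 1 : ℕ) : ℝ) = (((k + c₀) ^ c₀ + 4 * k + 7 : ℕ) : ℝ) := congrArg Nat.cast hE0
    rw [hE']
    have hg' : ((2 : ℝ) ^ (k - 1)) ≤ ((r / 2 : ℕ) : ℝ) := by exact_mod_cast hg
    calc (((k + c₀) ^ c₀ + 4 * k + 7 : ℕ) : ℝ) ≤ c * 2 ^ (k - 1) := hpoly
      _ ≤ c * ((r / 2 : ℕ) : ℝ) := by exact mul_le_mul_of_nonneg_left hg' hc.le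
  have hlast : (2 : ℝ) ^ (E + 1) ≤ (2 : ℝ) ^ (c * ((r / 2 : ℕ) : ℝ)) := by
    have := Real.rpow_le_rpow_of_exponent_le (one_le_two : (1 : ℝ) ≤ 2) hexp
    rwa [Real.rpow_natCast] at this
  calc (2 : ℝ) ^ ((Nat.log 2 r + c₀) ^ c₀) + 4 * (r : ℝ) ^ 4
      = (2 : ℝ) ^ q + 4 * (r : ℝ) ^ 4 := by rw [hq]
    _ < (2 : ℝ) ^ q + (2 : ℝ) ^ (4 * k + 6) := by linarith
    _ ≤ (2 : ℝ) ^ (E + 1) := hN'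
    _ ≤ (2 : ℝ) ^ (c * ((r / 2 : ℕ) : ℝ)) := hlast

/-! ## B♯ ⇒ B -/

/-- **`QueueGridPPHard` from the AFHMS 2019 grid bound.**  With (A) of the line this makes K1
(`Theses.FifoMatching.NFPolytopeQuasiPolyXC`) a consequence of (A1) + one print fact. -/
theorem queueGridPPHard_of_AFHMS (hB : AFHMS2019Grid) : QueueGridPPHard := by
  intro c₀
  obtain ⟨c, hc, hev⟩ := hB
  obtain ⟨T₀, hT₀⟩ := Filter.eventually_atTop.mp hev
  obtain ⟨r₁, hr₁2, hgrowth⟩ := growth_eventually c₀ hc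
  refine ⟨max r₁ (2 * T₀), fun r hr t ht => ?_⟩
  have hr₁ : r₁ ≤ r := le_trans (le_max_left _ _) hr
  have hrT : 2 * T₀ ≤ r := le_trans (le_max_right _ _) hr
  set g := r / 2 with hgdef
  have hg2 : 2 * g ≤ r := by omega
  have hgT : T₀ ≤ g := by omega
  -- transport the EF to COR(G_{g,g}) and apply the fact
  have hcor := hasEFOfSize_cor_of_pp r g hg2 t ht
  rw [card_patternIndex] at hcor
  have hfact := hT₀ g hgT (4 * r ^ 4 + t) hcor
  have hgr := hgrowth r hr₁
  -- compare
  have hcast : (((4 * r ^ 4 + t : ℕ)) : ℝ) = 4 * (r : ℝ) ^ 4 + (t : ℝ) := by push_cast; ring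
  rw [hcast] at hfact
  have hreal : ((2 ^ ((Nat.log 2 r + c₀) ^ c₀) : ℕ) : ℝ) < (t : ℝ) := by
    push_cast
    linarith
  exact_mod_cast hreal

/-- the same from the grid-minor form of the fact -/
theorem queueGridPPHard_of_AFHMS_minor (hM : AFHMS2019GridMinor) : QueueGridPPHard :=
  queueGridPPHard_of_AFHMS (afhms2019Grid_of_gridMinor hM)

end

/-! ### By name, from A1 + the print fact -/

/-- K1 BY NAME from the combinatorial heart A1 and the AFHMS grid fact (grid-only form). -/
theorem NFPolytopeQuasiPolyXC_of_AFHMS (hA : QueueGridZeroOnePoints) (hB : AFHMS2019Grid) :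
    Summit.ValiantsHypothesis.ValiantsHypothesis.Theses.FifoMatching.NFPolytopeQuasiPolyXC :=
  NFPolytopeQuasiPolyXC_of hA (queueGridPPHard_of_AFHMS hB)

/-- K1 BY NAME from A1 and the grid-minor form of the fact (R147 (a) typing). -/
theorem NFPolytopeQuasiPolyXC_of_AFHMS_minor (hA : QueueGridZeroOnePoints) (hB : AFHMS2019GridMinor) :
    Summit.ValiantsHypothesis.ValiantsHypothesis.Theses.FifoMatching.NFPolytopeQuasiPolyXC :=
  NFPolytopeQuasiPolyXC_of hA (queueGridPPHard_of_AFHMS_minor hB)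

/-! ### Registered stubs of line `queue_grid_face` (the ONLY `sorry`s of this file)

* `stub_zeroOnePoints` — A1, size L (tree vocabulary: `nestFreeMatchings`, `arcExponent`,
  `support_nestFreeMatchingPoly`; content: the closed-form layout-B arc set, the design matchings are nest-free,
  the rigidity induction of the line card §4–§5, the read-out).  Prover target (qg1 g0 / c1 g5, R150).
* `stub_afhms` — the ONE print fact of input B in the R147 (a) grid-minor typing (val-lit-p9's Literature module
  `CorrelationPolytopeGridMinor`; swap the local copy for the Literature name at landing).  NOT a prover target. -/

/-- stub A1 (see `QueueGridZeroOnePoints`). -/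
theorem stub_zeroOnePoints : QueueGridZeroOnePoints := by
  sorry

/-- stub B♯ = the print fact (see `AFHMS2019GridMinor`). -/
theorem stub_afhms : AFHMS2019GridMinor := by
  sorry

/-- the route item from the registered stubs (sorryAx enters only through `stub_zeroOnePoints`, `stub_afhms`). -/
theorem NFPolytopeQuasiPolyXC_of_stubs :
    Summit.ValiantsHypothesis.ValiantsHypothesis.Theses.FifoMatching.NFPolytopeQuasiPolyXC :=
  NFPolytopeQuasiPolyXC_of_AFHMS_minor stub_zeroOnePoints stub_afhms

/-! ### audit -/
#print axioms nfp_xc_of_queueGrid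
#print axioms faceOfNonnegHull
#print axioms queueGridFaceProjection_of_points
#print axioms queueGridPPHard_of_AFHMS
#print axioms NFPolytopeQuasiPolyXC_of_stubs

end Summit.ValiantsHypothesis.ValiantsHypothesis.Cruxes.NNLinearDegreeCofactorHard.QueueGridFace
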